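import Literature.MathematicalPhysics.QuantumFieldTheory.Balaban1983to89.B15Prop1IntrinsicReading
import Literature.MathematicalPhysics.QuantumFieldTheory.Balaban1983to89.B15Prop1IntrinsicAnalyticExt

/-!
# `Balaban1983to89.B15Prop1IntrinsicAnalyticAtRecord` — [Balaban1989LargeFieldI] Prop. 1 p. 194 WITH ITS LAST CLAUSE, AT THE RECORD, IN THE
# INTRINSIC READING: the N12∕s1 endpoint `B15Prop1IntrinsicReading.exists_domain_prop1Printed_lfVarOn_std_su2_box_intrinsic'` (p513628, v1.1 p516868) with
# the analytic-extension slot `An := anExt …` INSTANTIATED and its letter DISCHARGED from ONE jointly holomorphic extension of print's function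
# `(p, B′) ↦ A(U_{k,Z}(exp(iB′)·ext(exp(ip)V_k)))` — [Balaban1989LargeFieldII] p. 359 *«The above equations, bounds and statements are valid for
# 𝔤ᶜ-valued fields, hence the existence of the analytic extension follows immediately, and Proposition 1 [IV] is proved»*

statement-level skeleton of published theorems with citation tags; proofs where landed; nothing here is a claim about
the Yang–Mills mass gap

Cell pub-ymgap, HUMAN RULING D-0062 (Track A full width), seat `pub-ymgap-dag-n12-c` (R134 acceleration seat (a), strategy s1 of DAG node N12 = [B15];
generation g5, fifth product).  PDFs held: `paper:balaban1989-cmp122-large-field-i` (p. 194), `…-large-field-ii` (pp. 357–359 = PDF 3–5).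

WHAT THIS FILE PROVES (no `sorry`, no definition, no `… : Prop` fact; axioms standard).  ★★★
**`exists_domain_prop1Printed_lfVarOn_std_su2_box_intrinsic_analytic`**: `∃ a₁ > 0, B15.Prop1Printed (lfVarOn su2Chart (InstOn.std bg M₁ Z Λ k M a₁ An))`
with `An i := anExt (pts (k i) (Λ i)) (T i) (A∘U_{k,Z}) (ext i) (rA i)` — Proposition 1 [IV] AS PRINTED at print's instance, INCLUDING its last clause
(typed `B15Prop1AnalyticExtClause.anExt`, p504654) at the explicit radius `rA = min(1/2, R/8, (γ/M⁵)(R/2)²/(48(4𝓐/R+1)))` — from, besides the structural ∕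
constant hypotheses and the (181) covariance exactly as in the chain:
(J1) `hGj` — ONE letter of JOINT HOLOMORPHY at `eR`-regular data: the function `(p, B′) ↦ A(U_{k,Z}(exp(iB′)·ext(exp(ip)V_k)))` agrees, for real
  `‖p‖, ‖B′‖ < R`, with a function `𝒢` complex-differentiable on the sup-ball `‖(p̃, B̃′)‖ < R` of pairs of `𝔤ᶜ`-valued bond fields and bounded by `𝓐`
  there ([15] Thm 1: analyticity of the minimizer in the data; [IV] p. 193: the extension is built from `V_k` by group operations; [LF-II] p. 359);
(L2) `hlead` + `hsm`∕`hγle` — (1.7)–(1.9) for the Hessian of the slice function at `0`;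
(L3) `hJ` — the smallness of its gradient at `0` at ε-regular data, `ε ≤ eR` (v1.1 endpoint `…_intrinsic'`).
NOTHING ELSE: no `H_{1,k}`, `Δ₁(ζ₀)`, `(δ/δA)V`, `J_{k,Z}`, `W`, complexified operators, currents, `hc3p`, `hAn`, `eA`.  The (c3)∕(1.12) letter at the
perturbed data and the complex (1.9) are DERIVED (p. 359's chart machinery `B15Prop1CriticalViaSlice.isCriticalPt_iff_of_hasDerivAt` at print's `G₀`,
the Λ-invariance from (181), `B15Prop1SliceTaylorCalculus.slice_package_of_holomorphic`; `B15Prop1SliceIneq18.ineq19_slice_of_17` with (1.67)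
`B15Prop1SliceIneq167.circ_le_sum_formDk` BY NAME), and the clause comes from `B15Prop1IntrinsicAnalyticExt.anExt_of_jointHolomorphic` (Earle–Hamilton +
the Banach Weierstrass theorem, `B15Prop1ParametricZeroBranch`, p516033), with `eA` and all radii CHOSEN inside.
ALSO: `hessian_coercive_of_hlead` ((1.9) at the record from the Hessian letter: `(γ/M⁵)‖u‖² ≤ ⟪u, D(rGrad g)(0)u⟫`, by name from (1.67) + (1.8)) and the
anti-vacuity census `not_hlead_of_flat` (a slice function constant near `0` — a junk background — cannot satisfy (L2) with `hsm`, `hγle`).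

HONEST SCOPE.  (i) (J1), (L2), (L3) are NODE 00's pieces of record in print's own currency; nothing of theirs is proved here.  (ii) The clause's
matching radius `rA` and analyticity radius are explicit and small (print: *«B′ ∈ 𝔤ᶜ and small, e.g., |B′| < ε»*).  (iii) `SU(2)`, parallelepipeds not
wrapping the torus, `d ≥ 3`, x₁-axial `G₀`, the p. 193 extension.  Count-neutral; NOT a discharge of N12; NOT summit progress; nothing continuum ∕ OS ∕
mass-gap ∕ Clay.
-/

noncomputable section

open Set Finset Metric
open scoped BigOperators Matrix RealInnerProductSpace Real InnerProductSpace

namespace Literature.MathematicalPhysics.QuantumFieldTheory.Balaban1983to89.B15Prop1IntrinsicAnalyticAtRecord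

open B15DeterminingSets GaugeField B16Sect1Backgrounds B15Prop1Carrier B8Eq17ClassAkV1
open B15Prop1LocalLettersRecord B15Prop1SliceTaylorCalculus B15Prop1IntrinsicReading B15Prop1IntrinsicAnalyticExt B15Prop1ParametricZeroBranch
open B15Prop1CriticalViaSlice (isCriticalPt_iff_of_hasDerivAt)
open B15Prop1CriticalAtBoxG0 (treeOrder_G0 tgt_G0_mem)
open B15Prop1ChartRecentering (exists_hasFDerivAt_of_differentiableAt)
open B15Prop1SliceIneq18 (ineq19_slice_of_17)
open B15Prop1SliceIneq167 (circ_le_sum_formDk ineq17_of_lead)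
open B15Prop1AnalyticExtClause (cplxVec cplxSlice cplxSlice_apply norm_cplxSlice norm_cplxVec reSlice anExt anExt_antitone)
open B15Prop1ChartCalculusSU2 (E3)
open T4CubeChartGnomonic (SU2)
open B15Prop1ChartSU2 (su2Chart)
open B15Prop1SliceCoordinates (GaugeSlice ιA freeBonds norm_ιA_apply_le)
open T4AxialGaugeSmallField (castSite boxPlaqs)
open T4AxialGaugeFixing (TreeOrder boxDepth)
open B7Prop1Explicit (e e_apply)
open B6BondElimination (unitVec)
open B6TreeGaugePoincare (curl)
open B16Eq18Proof (box mem_box)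
open B15Extension193 (extend)
open B15ShellGauge193 (shellGauge)
open B5Bounds167Lattice (formDk ofRealCfg)
open B14.Eq213DetSet B14.Eq216Concrete B14.Eq12InteriorLocality B15Sect1Instances B15Eq177GaugeInvariance
open Literature.MathematicalPhysics.QuantumFieldTheory.BalabanImbrieJaffe1984to88.BIJ85Eq453GaugeField
open B11Prop6Scheme (Prop4Hyp)

section Std

open Classical

variable {P : Params}

/-- The integer box `{lo ≤ x ≤ hi}` is `B16Eq18Proof.box (hi − lo + 1) lo` (as in `B15Prop1CarrierOnSU2BoxIneq19`, where it is private).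
[cite: Balaban1989LargeFieldII, (1.8) p.358] -/
private theorem box_toNat_coe (lo hi : Fin P.d → ℤ) :
    (↑(box (fun i => (hi i - lo i + 1).toNat) lo) : Set (Fin P.d → ℤ)) = Set.Icc lo hi := by
  ext x
  simp only [Finset.mem_coe, mem_box, Set.mem_Icc]
  constructor
  · intro h
    refine ⟨fun i => (h i).1, fun i => ?_⟩
    have h2 := (h i).2
    have : ((hi i - lo i + 1).toNat : ℤ) ≤ max (hi i - lo i + 1) 0 := by
      rw [Int.toNat_eq_max]
    have hm : max (hi i - lo i + 1) 0 = hi i - lo i + 1 ∨ max (hi i - lo i + 1) 0 = 0 := max_choice _ _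
    rcases hm with hm | hm <;> rw [hm] at this <;> linarith [(h i).1]
  · rintro ⟨h1, h2⟩ i
    refine ⟨h1 i, ?_⟩
    have : (hi i - lo i + 1).toNat = hi i - lo i + 1 := Int.toNat_of_nonneg (by linarith [h1 i, h2 i])
    rw [this]
    linarith [h2 i]

/-- `cplxVec 0 = 0`. [cite: Balaban1989LargeFieldI, Prop. 1 p.194] -/
private theorem cplxVec_zero {k : ℕ} : cplxVec (0 : VecField P k E3) = 0 := by
  funext b; ext i; simp [cplxVec]

/-- The radii of the intrinsic analytic extension (print's *«B′ ∈ 𝔤ᶜ and small»* ∕ *«for ε sufficiently small»* bookkeeping): with `c = γ/M⁵`, `𝓑 = 4𝓐/R + 1`,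
`rA = min(1/2, R/8, c(R/2)²/(48𝓑))`, `r′ = 2rA`, `εA = min(r′, c·r′·(R/2)/(12𝓑))`, `eJ = c·r′/(6(cJ+1))`, all the smallness conditions of
`anExt_of_jointHolomorphic` hold. [cite: Balaban1989LargeFieldII, (1.13) p.359] -/
private theorem radii_bookkeeping {R 𝓐 γ M cJ : ℝ} (hR : 0 < R) (h𝓐 : 0 ≤ 𝓐) (hγ : 0 < γ) (hM : 1 ≤ M) (hcJ : 0 ≤ cJ) :
    let c := γ / M ^ 5
    let 𝓑 := 4 * 𝓐 / R + 1
    let rA := min (1 / 2) (min (R / 8) (c * (R / 2) ^ 2 / (48 * 𝓑)))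
    let εA := min (2 * rA) (c * (2 * rA) * (R / 2) / (12 * 𝓑))
    let eJ := c * (2 * rA) / (6 * (cJ + 1))
    0 < c ∧ 0 < rA ∧ rA ≤ 1 / 2 ∧ rA < 2 * rA ∧ 2 * rA ≤ R / 4 ∧ 2 * rA ≤ c * (R / 2) ^ 2 / (24 * 𝓑) ∧ 0 < εA ∧ εA ≤ 2 * rA ∧
      εA ≤ c * (2 * rA) * (R / 2) / (12 * 𝓑) ∧ 0 < eJ ∧ cJ * eJ ≤ c * (2 * rA) / 6 := by
  intro c 𝓑 rA εA eJ
  have hM0 : 0 < M := by linarith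
  have hc : 0 < c := by positivity
  have h𝓑 : 0 < 𝓑 := by positivity
  have hrA : 0 < rA := lt_min (by norm_num) (lt_min (by linarith) (by positivity))
  have hrA2 : rA ≤ 1 / 2 := min_le_left _ _
  have hrAR : rA ≤ R / 8 := (min_le_right _ _).trans (min_le_left _ _)
  have hrAc : rA ≤ c * (R / 2) ^ 2 / (48 * 𝓑) := (min_le_right _ _).trans (min_le_right _ _)
  have hεA : 0 < εA := lt_min (by linarith) (by positivity)
  have heJ : 0 < eJ := by positivity
  refine ⟨hc, hrA, hrA2, by linarith, by linarith, ?_, hεA, min_le_left _ _, min_le_right _ _, heJ, ?_⟩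
  · have e : c * (R / 2) ^ 2 / (24 * 𝓑) = 2 * (c * (R / 2) ^ 2 / (48 * 𝓑)) := by field_simp; ring
    rw [e]; linarith
  · have e : cJ * eJ = (cJ / (cJ + 1)) * (c * (2 * rA) / 6) := by
      show cJ * (c * (2 * rA) / (6 * (cJ + 1))) = cJ / (cJ + 1) * (c * (2 * rA) / 6)
      field_simp
    rw [e]
    have h1 : cJ / (cJ + 1) ≤ 1 := by rw [div_le_one (by linarith)]; linarith
    have h2 : 0 ≤ c * (2 * rA) / 6 := by positivity
    calc cJ / (cJ + 1) * (c * (2 * rA) / 6) ≤ 1 * (c * (2 * rA) / 6) := mul_le_mul_of_nonneg_right h1 h2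
      _ = c * (2 * rA) / 6 := one_mul _

/-- **THE COMPLEX∕REAL (1.9) AT THE RECORD FROM THE HESSIAN LETTER** — *«The inequalities (1.7), (1.8) imply finally … (1.9)»* (p. 358) in the
intrinsic reading: at print's box instance (`Λ^{(k)} = castSite″[lo,hi]`, `T = G₀`, margin 5, sides `≤ K`), the letter (L2) for a datum `V_k` together
with the constant conditions `hsm`, `hγle` gives the coercivity `(γ/M⁵)‖u‖² ≤ ⟪u, D(rGrad g)(0) u⟫` of the slice Hessian — (1.67) [10]
(`B15Prop1SliceIneq167.circ_le_sum_formDk`) and the x₁-axial (1.8) (`B15Prop1SliceIneq18.ineq19_slice_of_17`) BY NAME.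
[cite: Balaban1989LargeFieldII, (1.7)–(1.9) p.358; Balaban1984PropagatorsI, (1.67) p.29] -/
theorem hessian_coercive_of_hlead (hd3 : 3 ≤ P.d) (h0 : 0 < P.d) {k : ℕ} {Λ : Set (Site P 0)} {T : Finset (PBond P k)}
    {lo hi : Fin P.d → ℤ} (hbox : pts k Λ = (castSite '' Set.Icc lo hi : Set (Site P k)))
    (hTG0 : T = (box (fun κ => (hi κ - lo κ + 1).toNat) lo).image fun x => (⟨castSite (x - unitVec ⟨0, h0⟩), ⟨0, h0⟩⟩ : PBond P k))
    (hN5 : ∀ κ, ((hi κ - lo κ + 1).toNat : ℤ) + 5 < P.sitesPerDir k) {K : ℕ} (hK1 : 1 ≤ K) (hKn : ∀ κ, (hi κ - lo κ + 1).toNat ≤ K)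
    {γ M Cerr : ℝ} {n' : ℕ} (hn' : 1 ≤ n') (g : GaugeSlice (pts k Λ) T E3 → ℝ)
    (hlead : ∀ X : GaugeSlice (pts k Λ) T E3,
      |⟪X, (fderiv ℝ (rGrad (pts k Λ) T g) 0) X⟫ -
          ∑ a : Fin 3, formDk n' (fun _ : Fin P.d => P.sitesPerDir k)
            (ofRealCfg (fun _ : Fin P.d => P.sitesPerDir k) fun j => ιA (pts k Λ) T X ⟨j.1, j.2⟩ a)| ≤ Cerr * ‖X‖ ^ 2)
    (hsm : Cerr ≤ (4 / Real.pi ^ 2) ^ (P.d + 2) / (2 * (3 * (K : ℝ) ^ 2 + 2 * (K : ℝ) ^ 4)))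
    (hγle : γ / M ^ 5 ≤ (4 / Real.pi ^ 2) ^ (P.d + 2) / (2 * (3 * (K : ℝ) ^ 2 + 2 * (K : ℝ) ^ 4))) (u : GaugeSlice (pts k Λ) T E3) :
    γ / M ^ 5 * ‖u‖ ^ 2 ≤ ⟪u, fderiv ℝ (rGrad (pts k Λ) T g) 0 u⟫_ℝ := by
  have h1 : 1 < P.d := by omega
  have hm : ∀ κ, (((hi κ - lo κ + 1).toNat + 3 : ℕ) : ℤ) ≤ P.sitesPerDir k := fun κ => by
    have h5 := hN5 κ
    push_cast
    linarith
  have hS : pts k Λ = castSite '' (↑(box (fun κ => (hi κ - lo κ + 1).toNat) lo) : Set (Fin P.d → ℤ)) := by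
    rw [hbox, box_toNat_coe]
  have h17 : ∀ X : GaugeSlice (pts k Λ) T E3,
      (4 / Real.pi ^ 2) ^ (P.d + 2) *
          (∑ z ∈ box (fun κ => (hi κ - lo κ + 1).toNat + 3) (fun κ => lo κ - 2), ∑ μ : Fin P.d, ∑ a : Fin 3,
            curl (fun b => ιA (pts k Λ) T X (⟨castSite b.1, b.2⟩ : PBond P k) a) z ⟨0, h0⟩ μ ^ 2) -
        Cerr * ‖X‖ ^ 2 ≤
      inner ℝ ((LinearMap.id : _ →ₗ[ℝ] _) X)
        (((fderiv ℝ (rGrad (pts k Λ) T g) 0).toLinearMap) ((LinearMap.id : _ →ₗ[ℝ] _) X)) := fun X => by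
    have h := ineq17_of_lead (hlead X) (circ_le_sum_formDk h0 hn' (fun κ => lo κ - 2) hm (ιA (pts k Λ) T X))
    simpa only [LinearMap.id_coe, id_eq, ContinuousLinearMap.coe_coe] using h
  have h19 := ineq19_slice_of_17 h0 h1 hN5 hK1 (hKn ⟨0, h0⟩) (hKn ⟨1, h1⟩) hS hTG0 LinearMap.id
    ((fderiv ℝ (rGrad (pts k Λ) T g) 0).toLinearMap) (by positivity) h17 hsm u
  simp only [LinearMap.id_coe, id_eq, ContinuousLinearMap.coe_coe] at h19
  exact (mul_le_mul_of_nonneg_right hγle (sq_nonneg _)).trans h19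

/-- **THE HESSIAN LETTER HAS CONTENT (anti-vacuity census)**: at print's box instance, a slice function that is CONSTANT near `0` (what a junk background,
constant in the data, would give for print's function) cannot satisfy the letter (L2) together with `hsm`, `hγle` (`γ > 0`), as soon as the slice has a
non-zero coordinate vector — its Hessian at `0` vanishes while (1.9) forces `(γ/M⁵)‖X‖² ≤ ⟪X, D(rGrad g)(0)X⟫`. [cite: Balaban1989LargeFieldII, (1.9) p.358
(bookkeeping: the typed letter is not junk-satisfiable)] -/
theorem not_hlead_of_flat (hd3 : 3 ≤ P.d) (h0 : 0 < P.d) {k : ℕ} {Λ : Set (Site P 0)} {T : Finset (PBond P k)}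
    {lo hi : Fin P.d → ℤ} (hbox : pts k Λ = (castSite '' Set.Icc lo hi : Set (Site P k)))
    (hTG0 : T = (box (fun κ => (hi κ - lo κ + 1).toNat) lo).image fun x => (⟨castSite (x - unitVec ⟨0, h0⟩), ⟨0, h0⟩⟩ : PBond P k))
    (hN5 : ∀ κ, ((hi κ - lo κ + 1).toNat : ℤ) + 5 < P.sitesPerDir k) {K : ℕ} (hK1 : 1 ≤ K) (hKn : ∀ κ, (hi κ - lo κ + 1).toNat ≤ K)
    {γ M Cerr : ℝ} (hγ : 0 < γ) (hM : 1 ≤ M) {n' : ℕ} (hn' : 1 ≤ n') (g : GaugeSlice (pts k Λ) T E3 → ℝ)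
    (hflat : ∀ᶠ X in nhds (0 : GaugeSlice (pts k Λ) T E3), g X = g 0) (hne : ∃ X : GaugeSlice (pts k Λ) T E3, X ≠ 0)
    (hsm : Cerr ≤ (4 / Real.pi ^ 2) ^ (P.d + 2) / (2 * (3 * (K : ℝ) ^ 2 + 2 * (K : ℝ) ^ 4)))
    (hγle : γ / M ^ 5 ≤ (4 / Real.pi ^ 2) ^ (P.d + 2) / (2 * (3 * (K : ℝ) ^ 2 + 2 * (K : ℝ) ^ 4))) :
    ¬ ∀ X : GaugeSlice (pts k Λ) T E3,
      |⟪X, (fderiv ℝ (rGrad (pts k Λ) T g) 0) X⟫ -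
          ∑ a : Fin 3, formDk n' (fun _ : Fin P.d => P.sitesPerDir k)
            (ofRealCfg (fun _ : Fin P.d => P.sitesPerDir k) fun j => ιA (pts k Λ) T X ⟨j.1, j.2⟩ a)| ≤ Cerr * ‖X‖ ^ 2 := by
  haveI : ContinuousSMul ℝ (GaugeSlice (pts k Λ) T E3) := IsBoundedSMul.continuousSMul
  intro hlead
  obtain ⟨X, hX⟩ := hne
  -- the gradient vanishes near `0`, hence so does the Hessian at `0`
  have hgrad : rGrad (pts k Λ) T g =ᶠ[nhds 0] fun _ => (0 : GaugeSlice (pts k Λ) T E3) := by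
    have hopen : ∀ᶠ Y in nhds (0 : GaugeSlice (pts k Λ) T E3), ∀ᶠ Y' in nhds Y, g Y' = g 0 :=
      eventually_eventually_nhds.2 hflat
    filter_upwards [hopen] with Y hY
    have hD : HasFDerivAt g (0 : GaugeSlice (pts k Λ) T E3 →L[ℝ] ℝ) Y :=
      (hasFDerivAt_const (g 0) Y).congr_of_eventuallyEq hY
    show rieszR (pts k Λ) T (fderiv ℝ g Y) = 0
    rw [hD.fderiv, map_zero]
  have hH : fderiv ℝ (rGrad (pts k Λ) T g) 0 = 0 := by
    rw [hgrad.fderiv_eq, fderiv_const_apply]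
  have hc := hessian_coercive_of_hlead hd3 h0 hbox hTG0 hN5 hK1 hKn hn' g hlead hsm hγle X
  rw [hH, zero_apply, inner_zero_right] at hc
  have hM5 : 0 < M ^ 5 := by positivity
  have hpos : 0 < γ / M ^ 5 * ‖X‖ ^ 2 := mul_pos (div_pos hγ hM5) (by positivity)
  linarith

/-- ★★★ **PROPOSITION 1 [IV] WITH ITS ANALYTIC-EXTENSION CLAUSE, AT THE RECORD, IN THE INTRINSIC READING.**  See the module docstring.  The slot
`An i := anExt (pts (k i) (Λ i)) (T i) (A∘U_{k,Z}) (ext i) (rA i)` with `rA i = min (1/2) (min (R i/8) ((γ/M i⁵)(R i/2)²/(48(4𝓐 i/R i + 1))))`; letters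
(J1) `hGj` (joint holomorphic extension at `eR`-regular data), (L2) `hlead` + `hsm`∕`hγle`, (L3) `hJ`; (181) + `hk`; structural hypotheses.  Conclusion:
`∃ a₁ > 0, B15.Prop1Printed (lfVarOn su2Chart (InstOn.std bg M₁ Z Λ k M a₁ An))`. [cite: Balaban1989LargeFieldI, Prop. 1 (1.77)–(1.78) p.194 (incl. the
last clause), p.193; Balaban1989LargeFieldII, (1.7)–(1.9) p.358, (1.11)–(1.13) p.359; Balaban1985Variational, (181) p.307] -/
theorem exists_domain_prop1Printed_lfVarOn_std_su2_box_intrinsic_analytic (hd3 : 3 ≤ P.d) (h0 : 0 < P.d) {ι : Type}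
    {av : ∀ j, Averaging P j SU2}
    (bg : DetBackground P SU2 av) (M₁ : ℕ) (Z Λ : ι → Set (Site P 0)) (k : ι → ℕ) (M : ι → ℝ) (hk : ∀ i, k i ≤ P.m + P.K)
    (eR : ι → ℝ) (heR : ∀ i, 0 < eR i)
    (h181 : ∀ i (u : GaugeTransf P (k i) SU2), Cov181 bg (Bj M₁ (Z i) (k i)) (blockLift (k i) u))
    (T : ∀ i, Finset (PBond P (k i)))
    (lo hi : ι → Fin P.d → ℤ) (n : ι → ℕ) (hn : ∀ i κ, hi i κ ≤ lo i κ + n i) (hN : ∀ i, n i + 2 < P.sitesPerDir (k i))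
    (hbox : ∀ i, pts (k i) (Λ i) = (castSite '' Set.Icc (lo i) (hi i) : Set (Site P (k i))))
    (hZ : ∀ i, (boxPlaqs (lo i - 1) (hi i + 1) : Set (Plaq P (k i))) ⊆ plaqsInside (pts (k i) (Z i)))
    (hTG0 : ∀ i, T i = (box (fun κ => (hi i κ - lo i κ + 1).toNat) (lo i)).image fun x =>
      (⟨castSite (x - unitVec ⟨0, h0⟩), ⟨0, h0⟩⟩ : PBond P (k i)))
    (hN5 : ∀ i κ, ((hi i κ - lo i κ + 1).toNat : ℤ) + 5 < P.sitesPerDir (k i))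
    (K : ι → ℕ) (hK1 : ∀ i, 1 ≤ K i) (hKn : ∀ i κ, (hi i κ - lo i κ + 1).toNat ≤ K i)
    (ext : ∀ i, GaugeField P (k i) SU2 → GaugeField P (k i) SU2)
    (hext : ∀ i Vk, ext i Vk = extend (pts (k i) (Λ i)) (shellGauge Vk (lo i) (hi i)) Vk)
    (hlohi : ∀ i, lo i ≤ hi i)
    {γ cJ bx : ℝ} (hγ : 0 < γ) (hcJ : 0 ≤ cJ) (hbx : 0 ≤ bx)
    (hbxM : ∀ i, 12 * (P.d : ℝ) * ((n i : ℝ) + 2) ^ 2 ≤ bx * (M i) ^ 2)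
    {Cerr R 𝓐 : ι → ℝ} (hM : ∀ i, 1 ≤ (M i)) (hR : ∀ i, 0 < R i) (h𝓐 : ∀ i, 0 ≤ 𝓐 i)
    (n' : ι → ℕ) (hn' : ∀ i, 1 ≤ n' i)
    -- (J1) the JOINT holomorphic extension of print's function in the datum perturbation and the field
    (hGj : ∀ i Vk, PlaqSmallOn (plaqsInside (pts (k i) (Z i ∩ (Λ i)ᶜ))) (eR i) Vk →
      ∃ 𝒢 : VecField P (k i) (EuclideanSpace ℂ (Fin 3)) × VecField P (k i) (EuclideanSpace ℂ (Fin 3)) → ℂ,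
        DifferentiableOn ℂ 𝒢 (ball 0 (R i)) ∧
        (∀ z ∈ ball (0 : VecField P (k i) (EuclideanSpace ℂ (Fin 3)) × VecField P (k i) (EuclideanSpace ℂ (Fin 3))) (R i), ‖𝒢 z‖ ≤ 𝓐 i) ∧
        ∀ p B' : VecField P (k i) E3, ‖p‖ < R i → ‖B'‖ < R i →
          𝒢 (cplxVec p, cplxVec B') =
            ((fun177std bg M₁ (Z i) (k i) (expMul su2Chart B' (ext i (expMul su2Chart p Vk))) : ℝ) : ℂ))
    -- (L2) (1.7)–(1.9) p.358 for the Hessian of the slice function at `0`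
    (hlead : ∀ i Vk, PlaqSmallOn (plaqsInside (pts (k i) (Z i ∩ (Λ i)ᶜ))) (eR i) Vk →
      ∀ X : GaugeSlice (pts (k i) (Λ i)) (T i) E3,
      |⟪X, (fderiv ℝ (rGrad (pts (k i) (Λ i)) (T i)
              (sliceFn (pts (k i) (Λ i)) (T i) (fun177std bg M₁ (Z i) (k i)) (ext i Vk))) 0) X⟫ -
          ∑ a : Fin 3, formDk (n' i) (fun _ : Fin P.d => P.sitesPerDir (k i))
            (ofRealCfg (fun _ : Fin P.d => P.sitesPerDir (k i)) fun j =>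
              ιA (pts (k i) (Λ i)) (T i) X ⟨j.1, j.2⟩ a)| ≤ Cerr i * ‖X‖ ^ 2)
    (hsm : ∀ i, Cerr i ≤ (4 / Real.pi ^ 2) ^ (P.d + 2) / (2 * (3 * (K i : ℝ) ^ 2 + 2 * (K i : ℝ) ^ 4)))
    (hγle : ∀ i, γ / (M i) ^ 5 ≤ (4 / Real.pi ^ 2) ^ (P.d + 2) / (2 * (3 * (K i : ℝ) ^ 2 + 2 * (K i : ℝ) ^ 4)))
    -- (L3) p.359: the gradient at `0` is small at regular data
    (hJ : ∀ i ε Vk, 0 < ε → ε ≤ eR i → PlaqSmallOn (plaqsInside (pts (k i) (Z i ∩ (Λ i)ᶜ))) ε Vk →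
      ‖rGrad (pts (k i) (Λ i)) (T i) (sliceFn (pts (k i) (Λ i)) (T i) (fun177std bg M₁ (Z i) (k i)) (ext i Vk)) 0‖ ≤ cJ * ε)
    : ∃ a₁ : ι → ℝ, (∀ i, 0 < a₁ i) ∧
      B15.Prop1Printed (lfVarOn su2Chart fun i => InstOn.std bg M₁ (Z i) (Λ i) (k i) (M i) (a₁ i)
        (anExt (pts (k i) (Λ i)) (T i) (fun177std bg M₁ (Z i) (k i)) (ext i)
          (min (1 / 2) (min (R i / 8) (γ / (M i) ^ 5 * (R i / 2) ^ 2 / (48 * (4 * 𝓐 i / R i + 1))))))) := by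
  -- the radii
  have hrb := fun i => radii_bookkeeping (hR i) (h𝓐 i) hγ (hM i) hcJ
  set rA : ι → ℝ := fun i => min (1 / 2) (min (R i / 8) (γ / (M i) ^ 5 * (R i / 2) ^ 2 / (48 * (4 * 𝓐 i / R i + 1)))) with hrAdef
  set εA : ι → ℝ := fun i => min (2 * rA i) (γ / (M i) ^ 5 * (2 * rA i) * (R i / 2) / (12 * (4 * 𝓐 i / R i + 1))) with hεAdef
  set eJ : ι → ℝ := fun i => γ / (M i) ^ 5 * (2 * rA i) / (6 * (cJ + 1)) with heJdef
  set eA : ι → ℝ := fun i => min (eR i) (min (εA i) (eJ i)) with heAdef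
  have heA : ∀ i, 0 < eA i := fun i => lt_min (heR i) (lt_min (hrb i).2.2.2.2.2.2.1 (hrb i).2.2.2.2.2.2.2.2.2.1)
  refine exists_domain_prop1Printed_lfVarOn_std_su2_box_intrinsic' hd3 h0 bg M₁ Z Λ k M _ hk eR heR h181 T lo hi n hn hN hbox hZ hTG0 hN5 K hK1
    hKn ext hext hlohi hγ hcJ hbx hbxM (eA := eA) heA hM hR h𝓐 n' hn' (fun i Vk hV => ?hGc) hlead hsm hγle hJ (fun i ε Vk hε hεA hV => ?hAn)
  case hGc =>
    -- (L1) is the `p̃ = 0` slice of (J1)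
    obtain ⟨𝒢, hd, hb, hr⟩ := hGj i Vk hV
    have h0R : ‖(0 : VecField P (k i) (EuclideanSpace ℂ (Fin 3)))‖ < R i := by rw [norm_zero]; exact hR i
    refine ⟨fun B => 𝒢 (0, B), differentiableOn_section 𝒢 hd h0R, fun Y hY => hb _ ?_, fun B' hB' => ?_⟩
    · rw [mem_ball_zero_iff] at hY ⊢
      exact norm_prodMk_lt h0R hY
    · have h := hr 0 B' (by rw [norm_zero]; exact hR i) hB'
      rw [cplxVec_zero, expMul_zero] at h
      exact h
  case hAn =>
    -- the datum is `eR`-regular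
    have hVR : PlaqSmallOn (plaqsInside (pts (k i) (Z i ∩ (Λ i)ᶜ))) (eR i) Vk := fun q hq =>
      (hV q hq).trans_le (hεA.trans (min_le_left _ _))
    obtain ⟨𝒢, hd, hb, hr⟩ := hGj i Vk hVR
    obtain ⟨hc, hrA0, hrA2, hrr', hr'R, hr'c, hεA0, hεr', hεc, heJ0, hcJe⟩ := hrb i
    have hεA_le : ε ≤ εA i := hεA.trans ((min_le_right _ _).trans (min_le_left _ _))
    refine anExt_antitone hεA_le ?_
    -- (c3)/(1.12) at the perturbed data, in the intrinsic reading: critical ⇒ the slice gradient vanishes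
    have hNw : ∀ κ, hi i κ - lo i κ + 1 < (P.sitesPerDir (k i) : ℤ) := fun κ => by
      have h5 := hN5 i κ
      have : hi i κ - lo i κ + 1 ≤ ((hi i κ - lo i κ + 1).toNat : ℤ) := Int.self_le_toNat _
      linarith
    have hT : TreeOrder (T i) PBond.tgt (boxDepth (lo i - e ⟨0, h0⟩) (hi i)) := by
      rw [hTG0 i]; exact treeOrder_G0 h0 hNw
    have hv : ∀ b ∈ T i, b.tgt ∈ pts (k i) (Λ i) := fun b hb => by
      rw [hbox i]; rw [hTG0 i] at hb; exact tgt_G0_mem h0 (lo i) (hi i) b hb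
    have hf : ∀ u : GaugeTransf P (k i) SU2, IsGaugeOn (pts (k i) (Λ i)) u →
        ∀ V, fun177std bg M₁ (Z i) (k i) (gaugeAct u V) = fun177std bg M₁ (Z i) (k i) V :=
      fun u _ V => fun177_gaugeAct bg M₁ (hk i) u (h181 i u) V
    have hcrit : ∀ p : VecField P (k i) E3, ‖p‖ < R i / 2 → ∀ B : GaugeSlice (pts (k i) (Λ i)) (T i) E3, ‖B‖ ≤ rA i →
        IsCriticalPt su2Chart (bondsOf (pts (k i) (Λ i))) (fun177std bg M₁ (Z i) (k i))
            (expMul su2Chart (ιA (pts (k i) (Λ i)) (T i) B) (ext i (expMul su2Chart p Vk))) →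
          rGrad (pts (k i) (Λ i)) (T i)
            (sliceFn (pts (k i) (Λ i)) (T i) (fun177std bg M₁ (Z i) (k i)) (ext i (expMul su2Chart p Vk))) B = 0 := by
      intro p hp B hB hcr
      have hpR : ‖p‖ < R i := by linarith [hR i]
      have hpC : ‖cplxVec p‖ < R i := by rw [norm_cplxVec]; exact hpR
      -- the section of `𝒢` at `cplxVec p` extends print's function at the perturbed datum
      have hsec := slice_package_of_holomorphic (pts (k i) (Λ i)) (T i) (fun177std bg M₁ (Z i) (k i))
        (ext i (expMul su2Chart p Vk)) (hR i) (fun Bc => 𝒢 (cplxVec p, Bc)) (differentiableOn_section 𝒢 hd hpC)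
        (fun Y hY => hb _ (by rw [mem_ball_zero_iff] at hY ⊢; exact norm_prodMk_lt hpC hY))
        (fun B' hB' => hr p B' hpR hB')
      obtain ⟨hdiff, hderiv, -, -⟩ := hsec
      have hBR : ‖B‖ < R i := by linarith [hR i]
      have hB2 : ‖B‖ ≤ 1 / 2 := hB.trans hrA2
      have hX : ∀ b, ‖ιA (pts (k i) (Λ i)) (T i) B b‖ < π := fun b =>
        (norm_ιA_apply_le B b).trans_lt (hB2.trans_lt (by linarith [Real.pi_gt_three]))
      obtain ⟨D, hD⟩ := exists_hasFDerivAt_of_differentiableAt _ (ext i (expMul su2Chart p Vk)) hX (hdiff B hBR)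
      set g := sliceFn (pts (k i) (Λ i)) (T i) (fun177std bg M₁ (Z i) (k i)) (ext i (expMul su2Chart p Vk)) with hg
      have hiff := isCriticalPt_iff_of_hasDerivAt hT hv hf (ext i (expMul su2Chart p Vk)) hB2 hD
        (L := fun δ => ⟪δ, rGrad (pts (k i) (Λ i)) (T i) g B⟫_ℝ) (fun δ => by
          have h := hderiv B δ hBR
          rw [← inner_rGrad_eq_taylor] at h
          simpa only [hg, sliceFn_apply] using h)
      have hall := hiff.1 hcr
      exact inner_self_eq_zero.1 (hall _)
    -- (J3) the complex (1.9): positivity of the real Hessian from (1.7) + (1.67) + (1.8)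
    have hpos := hessian_coercive_of_hlead hd3 h0 (hbox i) (hTG0 i) (hN5 i) (hK1 i) (hKn i) (hn' i)
      (sliceFn (pts (k i) (Λ i)) (T i) (fun177std bg M₁ (Z i) (k i)) (ext i Vk)) (hlead i Vk hVR) (hsm i) (hγle i)
    -- (J4) the gradient at `0`
    have hj : ‖rGrad (pts (k i) (Λ i)) (T i) (sliceFn (pts (k i) (Λ i)) (T i) (fun177std bg M₁ (Z i) (k i)) (ext i Vk)) 0‖ ≤
        cJ * eA i :=
      (hJ i ε Vk hε (hεA.trans (min_le_left _ _)) hV).trans (mul_le_mul_of_nonneg_left hεA hcJ)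
    have hjc : cJ * eA i ≤ γ / (M i) ^ 5 * (2 * rA i) / 6 :=
      (mul_le_mul_of_nonneg_left ((min_le_right _ _).trans (min_le_right _ _)) hcJ).trans hcJe
    exact anExt_of_jointHolomorphic (pts (k i) (Λ i)) (T i) (fun177std bg M₁ (Z i) (k i)) (ext i) Vk (hR i) (h𝓐 i) 𝒢 hd hb hr hcrit hc
      hpos hj hrA0 hrr' hr'R hr'c hεr' hεc hjc

end Std

end Literature.MathematicalPhysics.QuantumFieldTheory.Balaban1983to89.B15Prop1IntrinsicAnalyticAtRecord

end
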